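import Summits.AtomisticToContinuum.BoseEinsteinCondensation.Theorems.BECGroundStateSOSPeriodicIRBoundDefs
import Literature.MathematicalPhysics.QuantumManyBody.TorusFockLayer
import Literature.MathematicalPhysics.QuantumManyBody.PeriodicBoseGasMomentumSector
import Literature.MathematicalPhysics.QuantumManyBody.PeriodicConfigFourier
import HarnessLib

/-!
# Route `BECGroundStateSOS`, crux `PeriodicIRBound` (stmt-AtomisticToContinuum-3972), line `linear-ph-floor-wagner`,
# stub 5b `stub_wagnerFeynman` — shared objects and the registered sub-goal statements of its proof files

§2c. The objects shared by the proof files `BECGroundStateSOSPeriodicIRBoundWF*.lean` of stub 5b (the Wagner–Feynman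
moment bound `WagnerFeynmanBound` of `BECGroundStateSOSPeriodicIRBoundDefs`): the potential part `P_w[g]` of the form and
its real polarisation, the slice coefficient `h = a_kΦ/√(m+1)`, `‖w‖₁`, the mixed and exchange coefficients of the
first-quantised expansion of `P_w[a_k†Φ]`, the centre-of-mass Fourier components `Ψ_q`, the kinetic cross density, and the
shorthands `N_q(g) = ‖a_q g‖²`, `ε_q = |2πq/L|²`.

§2d. One `Prop` per proof file (`WF.Pkg.<File>`): the statement of that file's headline lemma, registered on the crux
ledger as the sub-goal `stub_wf<File>` (the files land as `--supports` helpers of the crux item). The chain is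
A (variational principles) · B (kinematics and regularity of `a_k`, `a_k†` on the core) · C (polarisation) ·
D (the form inequality `𝓔[a_kΦ] + 𝓔[a_k†Φ] ≤ (|k|² + 2(n+2)‖w‖₁/L³)‖Φ‖² + 𝓔[Φ] + 2Re B(Φ, n̂_kΦ)`, kinetic identity +
potential inequality) · E (centre-of-mass projection and the gap of its complement) · H (assembly), after
[cite: Wagner1966, §2–§3] and [cite: PitaevskiiStringari1991, §II (7)–(12)] in first quantisation ([cite: LSSY2005, App. A]).
-/

noncomputable section

open scoped BigOperators ENNReal ComplexConjugate
open Filter MeasureTheory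

namespace Summit.AtomisticToContinuum.BoseEinsteinCondensation.Cruxes.PeriodicIRBound.LinearPhFloorWagner

open Literature.MathematicalPhysics.QuantumManyBody.BoseGas

namespace WF

variable {M m : ℕ}

/-! ## §2c Shared objects -/

/-- The potential part `P_w[g] = ∫_{[0,L)^{3M}} W |g|²` of the form, `W = ∑_{i<j} w^per(xᵢ - xⱼ)`. [folklore] -/
def potForm (w : ℝ → ℝ≥0∞) (L : ℝ) (g : Config M → ℂ) : ℝ≥0∞ :=
  ∫⁻ X in cellN M L, periodicInteraction w L X * ((‖g X‖₊ : ℝ≥0∞)) ^ 2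

/-- The real polarised potential form `Re ∫ W conj(f) g`. [folklore] -/
def potRe (w : ℝ → ℝ≥0∞) (L : ℝ) (f g : Config M → ℂ) : ℝ :=
  ∫ X in cellN M L, (periodicInteraction w L X).toReal * (conj (f X) * g X).re

/-- The slice coefficient `h(Y) = ∫_{[0,L)³} conj(φ_k(x)) Φ(x :: Y) dx` (so that `a_k Φ = √(m+1) · h`). [cite: LSSY2005, App. A (A.3)] -/
def sliceCoef (L : ℝ) (k : Fin 3 → ℤ) (Φ : Config (m + 1) → ℂ) (Y : Config m) : ℂ :=
  ∫ x in cell L, conj (planeWaveMode L k x) * Φ (Matrix.vecCons x Y)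

/-- `‖w‖₁ = ∫_{ℝ³} w(|z|) dz` as a real number. [folklore] -/
def wL1 (w : ℝ → ℝ≥0∞) : ℝ := (∫⁻ z : Space, w ‖z‖).toReal

/-- The mixed coefficient `s_b = ∫_Y ∫_x w^per(x - y_b) conj Φ(x::Y) φ_k(x) h(Y)` (`b` a spectator of the slice). [folklore] -/
def mixCoef (w : ℝ → ℝ≥0∞) (L : ℝ) (k : Fin 3 → ℤ) (Φ : Config (m + 1) → ℂ) (b : Fin m) : ℂ :=
  ∫ Y in cellN m L, ∫ x in cell L, ((periodizedPotential w L (x - Y b)).toReal : ℂ) *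
    (conj (Φ (Matrix.vecCons x Y)) * planeWaveMode L k x * sliceCoef L k Φ Y)

/-- The exchange coefficient `E = ∫_{W'} ∫_x ∫_y w^per(x-y) conj φ_k(x) φ_k(y) conj Φ(y::W') Φ(x::W')`. [folklore] -/
def exchCoef (w : ℝ → ℝ≥0∞) (L : ℝ) (k : Fin 3 → ℤ) (Φ : Config (m + 1) → ℂ) : ℂ :=
  ∫ W' in cellN m L, ∫ x in cell L, ∫ y in cell L, ((periodizedPotential w L (x - y)).toReal : ℂ) *
    (conj (planeWaveMode L k x) * planeWaveMode L k y * conj (Φ (Matrix.vecCons y W')) * Φ (Matrix.vecCons x W'))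

/-- The centre-of-mass Fourier component of order `q`: `Ψ_q(X) = L⁻³ ∫_{s} e^{-2πi q·s/L} Ψ(X + s·𝟙) ds`
(`cellFourierCoeff` of the slice `s ↦ Ψ(X + s·𝟙)`); `Ψ_0 = PΨ`, and `Ψ_q` has total momentum `2πq/L`.
[cite: CorneanDerezinskiZin2009, §1.1] -/
def comCoeff (L : ℝ) (Ψ : Config M → ℂ) (q : Fin 3 → ℤ) (X : Config M) : ℂ :=
  cellFourierCoeff L (fun s => Ψ (fun i => X i + s)) q

/-- The kinetic cross density `∑_{i,c} Re(conj(∂_{i,c} f) ∂_{i,c} g)` (the integrand of `Re ∫ ∇f̄·∇g`). [folklore] -/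
def kinCross (f g : Config M → ℂ) (X : Config M) : ℝ :=
  ∑ i : Fin M, ∑ c : Fin 3,
    (conj (fderiv ℝ f X (Pi.single i (EuclideanSpace.single c (1 : ℝ)))) *
      fderiv ℝ g X (Pi.single i (EuclideanSpace.single c (1 : ℝ)))).re

/-- Shorthand: `N_q(g) = ‖a_q g‖²_{cell}`, the occupation of the mode `q` in the unnormalised `g`. [folklore] -/
def occ (L : ℝ) (q : Fin 3 → ℤ) (g : Config (m + 1) → ℂ) : ℝ≥0∞ :=
  normSq L (modeAn L (planeWaveMode L q) g)

/-- Shorthand: `ε_q = |2πq/L|²` in `ℝ≥0∞`. [folklore] -/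
def eps (L : ℝ) (q : Fin 3 → ℤ) : ℝ≥0∞ := ENNReal.ofReal (‖waveVector L q‖ ^ 2)

/-- `P_w[f] ≤ 𝓔_w[f]`. [folklore] -/
theorem potForm_le_qform' (w : ℝ → ℝ≥0∞) (L : ℝ) (f : Config M → ℂ) : potForm w L f ≤ qform w L f :=
  lintegral_mono fun _ => le_add_self

/-! ## §2d The registered sub-goal statements of the proof files -/

/-- Sub-goal `stub_wfVariational` (file `BECGroundStateSOSPeriodicIRBoundWFVariational.lean`): A1: `E₀(M,L) ‖f‖² ≤ 𝓔_w[f]` for every core `f`. -/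
def Pkg.Variational : Prop :=
    ∀ {M : ℕ} {L : ℝ} (_hL : 0 < L) {w : ℝ → ℝ≥0∞} (_hw : Measurable w) {f : Config M → ℂ} (hf : IsCore L f),
      periodicGroundStateEnergy w M L * normSq L f ≤ qform w L f

/-- Sub-goal `stub_wfRegularity` (file `BECGroundStateSOSPeriodicIRBoundWFRegularity.lean`): B1: `a_k Φ` is a core function when `Φ` is. -/
def Pkg.Regularity : Prop :=
    ∀ {n : ℕ} {L : ℝ} (hL : 0 < L) (k : Fin 3 → ℤ) {Φ : Config (n + 1) → ℂ} (hΦ : IsCore L Φ), IsCore L (modeAn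
      L (planeWaveMode L k) Φ)

/-- Sub-goal `stub_wfKinematics` (file `BECGroundStateSOSPeriodicIRBoundWFKinematics.lean`): B5: `‖a_k Φ‖² = N_k(Φ)`. -/
def Pkg.Kinematics : Prop :=
    ∀ {n : ℕ} {L : ℝ} (hL : 0 < L) (k : Fin 3 → ℤ) (Φ : Config (n + 1) → ℂ), normSq L (modeAn L (planeWaveMode L
      k) Φ) = cellOccupation (n + 1) L (planeWaveMode L k) Φ

/-- Sub-goal `stub_wfPolar` (file `BECGroundStateSOSPeriodicIRBoundWFPolar.lean`): C2: the near-minimiser cross-term bound `|Re B_w(f,g) − E₀ Re⟨f,g⟩| ≤ √δ √𝓔_w[g]`. -/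
def Pkg.Polar : Prop :=
    ∀ {M : ℕ} {L : ℝ} (hL : 0 < L) {w : ℝ → ℝ≥0∞} (hw : Measurable w) {f g : Config M → ℂ} (hf : IsCore L f) (hg
      : IsCore L g) (hfE : qform w L f ≠ ⊤) (hgE : qform w L g ≠ ⊤) (hE : periodicGroundStateEnergy w M L ≠ ⊤)
      {δ : ℝ} (hδ : 0 ≤ δ) (hnear : (qform w L f).toReal ≤ (periodicGroundStateEnergy w M L).toReal * (normSq L
      f).toReal + δ), |formRe w L f g - (periodicGroundStateEnergy w M L).toReal * innerRe L f g| ≤ Real.sqrt δ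
      * Real.sqrt ((qform w L g).toReal)

/-- Sub-goal `stub_wfComFourier` (file `BECGroundStateSOSPeriodicIRBoundWFComFourier.lean`): E1: `PΨ` is a core function of total momentum `0`. -/
def Pkg.ComFourier : Prop :=
    ∀ {M : ℕ} {L : ℝ} (hL : 0 < L) {Ψ : Config M → ℂ} (hΨ : IsCore L Ψ), IsCore L (comProj L Ψ) ∧
      HasTotalMomentum 0 (comProj L Ψ)

/-- Sub-goal `stub_wfComFourier2` (file `BECGroundStateSOSPeriodicIRBoundWFComFourier2.lean`): E1c: Parseval `∑_q ‖Ψ_q‖² = ‖Ψ‖²`. -/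
def Pkg.ComFourier2 : Prop :=
    ∀ {M : ℕ} {L : ℝ} (hL : 0 < L) {Ψ : Config M → ℂ} (hΨ : IsCore L Ψ), ∑' q : Fin 3 → ℤ, normSq L (comCoeff L
      Ψ q) = normSq L Ψ

/-- Sub-goal `stub_wfComGap` (file `BECGroundStateSOSPeriodicIRBoundWFComGap.lean`): E3: the gap of the orthogonal complement of the zero-momentum sector. -/
def Pkg.ComGap : Prop :=
    ∀ {M : ℕ} {L : ℝ} (hL : 0 < L) {w : ℝ → ℝ≥0∞} (hw : Measurable w) (hint : (∫⁻ x : Space, w ‖x‖) ≠ ⊤) (hM : 1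
      ≤ M) (hE : periodicGroundStateEnergy w M L ≠ ⊤) (hgap : ∀ q : Space, q ≠ 0 → periodicGroundStateEnergy w M
      L < momentumSectorEnergy w M L q), ∃ g : ℝ≥0∞, 0 < g ∧ ∀ Ψ : Config M → ℂ, IsCore L Ψ →
      (periodicGroundStateEnergy w M L + g) * normSq L (fun X => Ψ X - comProj L Ψ X) ≤ qform w L (fun X => Ψ X
      - comProj L Ψ X)

/-- Sub-goal `stub_wfPotToolkit` (file `BECGroundStateSOSPeriodicIRBoundWFPotToolkit.lean`): P-c: the exchange bound `|Re E| ≤ ‖w‖₁/L³ ‖Φ‖²`. -/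
def Pkg.PotToolkit : Prop :=
    ∀ {m : ℕ} {L : ℝ} (hL : 0 < L) {w : ℝ → ℝ≥0∞} (hw : Measurable w) (hint : (∫⁻ z : Space, w ‖z‖) ≠ ⊤) (k :
      Fin 3 → ℤ) {Φ : Config (m + 1) → ℂ} (hΦ : Continuous Φ), |(exchCoef w L k Φ).re| ≤ wL1 w / L ^ 3 * (normSq
      L Φ).toReal

/-- Sub-goal `stub_wfFormBounds` (file `BECGroundStateSOSPeriodicIRBoundWFFormBounds.lean`): P-d: `P_w[a_kΦ], P_w[a_k†Φ] < ∞` when `P_w[Φ] < ∞`. -/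
def Pkg.FormBounds : Prop :=
    ∀ {m : ℕ} {L : ℝ} (hL : 0 < L) {w : ℝ → ℝ≥0∞} (hw : Measurable w) (hint : (∫⁻ z : Space, w ‖z‖) ≠ ⊤) (k :
      Fin 3 → ℤ) {Φ : Config (m + 1) → ℂ} (hΦ : IsCore L Φ) (hP : potForm w L Φ ≠ ⊤), potForm w L (modeAn L
      (planeWaveMode L k) Φ) ≠ ⊤ ∧ potForm w L (modeCr (planeWaveMode L k) Φ) ≠ ⊤

/-- Sub-goal `stub_wfFormBounds2` (file `BECGroundStateSOSPeriodicIRBoundWFFormBounds2.lean`): B9: `𝓔[a_k†Φ] ≤ (n+1)(𝓔[Φ] + (|2πk/L|² + n‖w‖₁/L³)‖Φ‖²)`. -/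
def Pkg.FormBounds2 : Prop :=
    ∀ {n : ℕ} {L : ℝ} (hL : 0 < L) {w : ℝ → ℝ≥0∞} (hw : Measurable w) (hint : (∫⁻ x : Space, w ‖x‖) ≠ ⊤) (k :
      Fin 3 → ℤ) {Φ : Config n → ℂ} (hΦ : IsCore L Φ), qform w L (modeCr (planeWaveMode L k) Φ) ≤ (n + 1 : ℝ≥0∞)
      * (qform w L Φ + ENNReal.ofReal (‖latticeVec (2 * Real.pi / L) k‖ ^ 2 + n * (∫⁻ x : Space, w ‖x‖).toReal /
      L ^ 3) * normSq L Φ)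

/-- Sub-goal `stub_wfPotCross` (file `BECGroundStateSOSPeriodicIRBoundWFPotCross.lean`): `∫_{cell^M} W < ∞` for integrable `w`. -/
def Pkg.PotCross : Prop :=
    ∀ {L : ℝ} (hL : 0 < L) {w : ℝ → ℝ≥0∞} (hw : Measurable w) (hint : (∫⁻ z : Space, w ‖z‖) ≠ ⊤) (M : ℕ), ∫⁻ X
      in cellN M L, periodicInteraction w L X ≠ ⊤

/-- Sub-goal `stub_wfPotCross2` (file `BECGroundStateSOSPeriodicIRBoundWFPotCross2.lean`): P-a: `potRe_w(Φ, n̂_kΦ) = P_w[a_kΦ] + (m+1) ∑_b Re s_b`. -/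
def Pkg.PotCross2 : Prop :=
    ∀ {m : ℕ} {L : ℝ} (hL : 0 < L) {w : ℝ → ℝ≥0∞} (hw : Measurable w) (hint : (∫⁻ z : Space, w ‖z‖) ≠ ⊤) (k :
      Fin 3 → ℤ) {Φ : Config (m + 1) → ℂ} (hΦ : IsCore L Φ) (hP : potForm w L Φ ≠ ⊤), potRe w L Φ (modeCr
      (planeWaveMode L k) (modeAn L (planeWaveMode L k) Φ)) = (potForm w L (modeAn L (planeWaveMode L k)
      Φ)).toReal + (m + 1) * ∑ b : Fin m, (mixCoef w L k Φ b).re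

/-- Sub-goal `stub_wfPotCreate` (file `BECGroundStateSOSPeriodicIRBoundWFPotCreate.lean`): the symmetry reduction of `P_w[a_k†Φ]` to the diagonal and one off-diagonal pair integral. -/
def Pkg.PotCreate : Prop :=
    ∀ {m : ℕ} {L : ℝ} (hL : 0 < L) {w : ℝ → ℝ≥0∞} (hw : Measurable w) (hint : (∫⁻ z : Space, w ‖z‖) ≠ ⊤) (k :
      Fin 3 → ℤ) {Φ : Config (m + 1) → ℂ} (hΦ : IsCore L Φ) (hP : potForm w L Φ ≠ ⊤), (potForm w L (modeCr
      (planeWaveMode L k) Φ)).toReal = (∫⁻ Z in cellN (m + 2) L, periodicInteraction w L Z * (((‖planeWaveMode L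
      k (Z 0)‖₊ : ℝ≥0∞)) ^ 2 * ((‖Φ (Fin.tail Z)‖₊ : ℝ≥0∞)) ^ 2)).toReal + (m + 1) * (∫ Z in cellN (m + 2) L,
      ((periodicInteraction w L Z).toReal : ℂ) * (conj (planeWaveMode L k (Z 1) * Φ (Fin.removeNth 1 Z)) *
      (planeWaveMode L k (Z 0) * Φ (Fin.removeNth 0 Z)))).re

/-- Sub-goal `stub_wfPotCreate2` (file `BECGroundStateSOSPeriodicIRBoundWFPotCreate2.lean`): `h = a_kΦ/√(m+1)`. -/
def Pkg.PotCreate2 : Prop :=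
    ∀ {m : ℕ} (L : ℝ) (k : Fin 3 → ℤ) (Φ : Config (m + 1) → ℂ) (Y : Config m), sliceCoef L k Φ Y = ((Real.sqrt
      (m + 1) : ℝ) : ℂ)⁻¹ * modeAn L (planeWaveMode L k) Φ Y

/-- Sub-goal `stub_wfPotCreate3` (file `BECGroundStateSOSPeriodicIRBoundWFPotCreate3.lean`): P-b: `P[a_k†Φ] = P[Φ] + (m+1)‖w‖₁/L³‖Φ‖² + P[a_kΦ] + 2(m+1)∑_b Re s_b + (m+1) Re E`. -/
def Pkg.PotCreate3 : Prop :=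
    ∀ {m : ℕ} {L : ℝ} (hL : 0 < L) {w : ℝ → ℝ≥0∞} (hw : Measurable w) (hint : (∫⁻ z : Space, w ‖z‖) ≠ ⊤) (k :
      Fin 3 → ℤ) {Φ : Config (m + 1) → ℂ} (hΦ : IsCore L Φ) (hP : potForm w L Φ ≠ ⊤), (potForm w L (modeCr
      (planeWaveMode L k) Φ)).toReal = (potForm w L Φ).toReal + (m + 1) * wL1 w / L ^ 3 * (normSq L Φ).toReal +
      (potForm w L (modeAn L (planeWaveMode L k) Φ)).toReal + 2 * ((m + 1) * ∑ b : Fin m, (mixCoef w L k Φ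
      b).re) + (m + 1) * (exchCoef w L k Φ).re

/-- Sub-goal `stub_wfHeartKin` (file `BECGroundStateSOSPeriodicIRBoundWFHeartKin.lean`): K3: kinetic Parseval `T[g] = ∑_q |2πq/L|² ‖a_q g‖²` for core `g`. -/
def Pkg.HeartKin : Prop :=
    ∀ {m : ℕ} {L : ℝ} (hL : 0 < L) {g : Config (m + 1) → ℂ} (hg : IsCore L g), ∫⁻ X in cellN (m + 1) L,
      kineticDensity g X = ∑' q : Fin 3 → ℤ, ENNReal.ofReal (‖waveVector L q‖ ^ 2) * normSq L (modeAn L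
      (planeWaveMode L q) g)

/-- Sub-goal `stub_wfHeartKin2` (file `BECGroundStateSOSPeriodicIRBoundWFHeartKin2.lean`): the kinetic Wagner–Feynman identity `T[a_pΦ] + T[a_p†Φ] = |p|²‖Φ‖² + T[Φ] + 2(|p|² N_p(Φ) + ∑_q |q|² ‖a_p a_q Φ‖²)`. -/
def Pkg.HeartKin2 : Prop :=
    ∀ {n : ℕ} {L : ℝ} (hL : 0 < L) (p : Fin 3 → ℤ) {Φ : Config (n + 2) → ℂ} (hΦ : IsCore L Φ), (∫⁻ Y in cellN (n
      + 1) L, kineticDensity (modeAn L (planeWaveMode L p) Φ) Y) + ∫⁻ Z in cellN (n + 3) L, kineticDensity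
      (modeCr (planeWaveMode L p) Φ) Z = eps L p * normSq L Φ + (∫⁻ X in cellN (n + 2) L, kineticDensity Φ X) +
      2 * (eps L p * occ L p Φ + ∑' q : Fin 3 → ℤ, eps L q * normSq L (modeAn L (planeWaveMode L p) (modeAn L
      (planeWaveMode L q) Φ)))

/-- Sub-goal `stub_wfHeartGlue` (file `BECGroundStateSOSPeriodicIRBoundWFHeartGlue.lean`): D1: the Wagner–Feynman form inequality at particle number `n + 2`. -/
def Pkg.HeartGlue : Prop :=
    ∀ {n : ℕ} {L : ℝ} (hL : 0 < L) {w : ℝ → ℝ≥0∞} (hw : Measurable w) (hint : (∫⁻ x : Space, w ‖x‖) ≠ ⊤) {k :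
      Fin 3 → ℤ} (hk : k ≠ 0) {Φ : Config (n + 2) → ℂ} (hΦ : IsCore L Φ) (hΦE : qform w L Φ ≠ ⊤), (qform w L
      (modeAn L (planeWaveMode L k) Φ)).toReal + (qform w L (modeCr (planeWaveMode L k) Φ)).toReal ≤
      (‖latticeVec (2 * Real.pi / L) k‖ ^ 2 + 2 * (n + 2) * (∫⁻ x : Space, w ‖x‖).toReal / L ^ 3) * (normSq L
      Φ).toReal + (qform w L Φ).toReal + 2 * formRe w L Φ (modeCr (planeWaveMode L k) (modeAn L (planeWaveMode L
      k) Φ))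

/-- Sub-goal `stub_wfDefs` (this file): `P_w[f] ≤ 𝓔_w[f]`. -/
def Pkg.Defs : Prop :=
  ∀ {M : ℕ} (w : ℝ → ℝ≥0∞) (L : ℝ) (f : Config M → ℂ), potForm w L f ≤ qform w L f

end WF

/-- The registered sub-goal `stub_wfDefs` of the crux ledger (this file's lemma `WF.potForm_le_qform'`). -/
theorem stub_wfDefs : WF.Pkg.Defs :=
  @WF.potForm_le_qform'

end Summit.AtomisticToContinuum.BoseEinsteinCondensation.Cruxes.PeriodicIRBound.LinearPhFloorWagner

end
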